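import Literature.Analysis.FluidPDE.IntermittentJets
import Literature.Analysis.FluidPDE.CLVelocityEstimates
import Literature.Analysis.FunctionSpaces.TorusDerivBounds
import HarnessLib

/-!
# Intermittent jets: sup bounds of all space derivatives of the building blocks
  (Luo–Titi 2020, Prop. 4 / (3.16); Buckmaster–Vicol 2019 survey, (7.22)–(7.24))

Analysis/FluidPDE support file (everything proved; no named facts). The `L^p` size of the
`N`-th derivatives of the building blocks of an intermittent convex-integration scheme is
"`λ^N ×` (the size of the block)" — Luo–Titi, Calc. Var. PDE 59 (2020) = arXiv:1808.07595, §3.2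
Prop. 4 (3.6): "`‖∇^N ∂ₜ^K 𝕎_(ξ)‖_{L^p} ≲ λ^N (λσrμ)^K r^{3/2-3/p}`", and §3.4 Lemma 4 (3.16):
"`‖|∇|^N w_{q+1}‖_{L^p} ≲ r^{3/2-3/p} λ_{q+1}^N 𝒞_{N+1}`"; for the intermittent JETS used by the
tree (`FluidPDE/IntermittentJets`, after Buckmaster–Vicol, EMS Surv. Math. Sci. 6 (2019), §7.4)
the corresponding display is (7.22)–(7.24). This file proves the SUP-NORM form of these bounds for
all orders `N`, in the currency `Torus.HasDerivBounds N f C L` of `FunctionSpaces/TorusDerivBounds`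
(`‖∂^α f‖_∞ ≤ C L^{|α|}`, `|α| ≤ N`), with constants depending only on the order, the axial bump
`g` and the fixed transverse profiles — never on the large parameters `μ, κ, σ, ω`:

* `Intermittent.IsBump.iteratedDeriv_profile` — `(g_κ)^{(j)} = κ^j (g^{(j)})_κ`, whence
  `|(g_κ)^{(j)}| ≤ κ^{j} κ^{1/2} sup|g^{(j)}|`;
* `Jet.iterPartialDeriv_axialFn` — `∂^l P̃(χ_n y + r) = (∏_{i∈l} nᵢ) P̃^{(|l|)}(χ_n y + r)`; hence
  `Jet.hasDerivBounds_eta` / `Jet.hasDerivBounds_etaD`: the axial factors `η_x(t)`, `η'_x(t)` of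
  `IntermittentJets` have derivative bounds of every order with constants `A κ^{1/2}`,
  `A κ^{3/2}` and `L = 3σκ` (`|(k_x)ₗ| ≤ 3`);
* `Mikado.abs_iterPartialDeriv_pull_conc_le` / `Mikado.hasDerivBounds_pull_conc` — the transverse profiles: `j` derivatives of a
  pulled-back concentrated profile `conc κ₀ a μ f₀ ∘ L` cost `(Λμ)^j`, `Λ = ∑|A|` the size of the
  integer frame, on top of the height `|κ₀| μ^a sup|f₀|`; hence (`Jet.hasDerivBounds_psiJ`,
  `Jet.hasDerivBounds_partialDeriv_phiJ`, `Jet.hasDerivBounds_gradient_phiJ`) the transverse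
  factor `ψ̃_x` and the transverse potential gradient `∇φ̃_x` have derivative bounds of every
  order with constants `C μ^{(d-1)/2}`, `C σ⁻¹ μ^{(d-1)/2 - 1}` and `L = Λσμ`.

Products of these (the pieces `a η ψ̃ k`, `a σ|k|² η' ∇φ̃`, … of the perturbation) are then
bounded by the Leibniz rule `HasDerivBounds.mul/.smul` of `TorusDerivBounds`.

## References

* T. Luo, E. S. Titi, Calc. Var. PDE 59 (2020) = arXiv:1808.07595, §3.2 Prop. 4 (3.6), §3.4
  Lemma 4 (3.16). [`LuoTiti2020`]
* T. Buckmaster, V. Vicol, EMS Surv. Math. Sci. 6 (2019) = arXiv:1901.09023, §7.4 (7.22)–(7.24).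
  [`BuckmasterVicol2020`]
-/

noncomputable section

open MeasureTheory Set Function UnitAddTorus
open scoped ContDiff

namespace Literature.Analysis.FluidPDE

/-! ## One-dimensional profiles: iterated derivatives of `g_κ` -/

namespace Intermittent

variable {g : ℝ → ℝ} {κ : ℝ}

/-- Iterated derivatives of bumps are bumps. [folklore] -/
theorem isBump_iteratedDeriv (hg : IsBump g) : ∀ j : ℕ, IsBump (iteratedDeriv j g)
  | 0 => by simpa using hg
  | j + 1 => by
    rw [iteratedDeriv_succ]
    exact (isBump_iteratedDeriv hg j).deriv

/-- **`(g_κ)^{(j)} = κ^j (g^{(j)})_κ`** (`κ ≥ 1`): each derivative of the `κ`-concentrated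
periodic profile brings down a factor `κ`. [cite: BuckmasterVicol2020, §7.4 (7.22)] -/
theorem IsBump.iteratedDeriv_profile (hg : IsBump g) (hκ : 1 ≤ κ) (j : ℕ) :
    iteratedDeriv j (profile κ g) = fun s => κ ^ j * profile κ (iteratedDeriv j g) s := by
  induction j generalizing g with
  | zero => funext s; simp
  | succ j ih =>
    funext s
    rw [iteratedDeriv_succ', hg.deriv_profile hκ, iteratedDeriv_const_mul_field, ih hg.deriv,
      ← iteratedDeriv_succ']
    ring

/-- **Sup bound of the iterated derivatives of `g_κ`**: `|(g_κ)^{(j)}| ≤ κ^j κ^{1/2} sup|g^{(j)}|`.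
[cite: BuckmasterVicol2020, §7.4 (7.22)] -/
theorem IsBump.abs_iteratedDeriv_profile_le (hg : IsBump g) (hκ : 1 ≤ κ) (j : ℕ) {B : ℝ}
    (hB : ∀ s, |iteratedDeriv j g s| ≤ B) (s : ℝ) :
    |iteratedDeriv j (profile κ g) s| ≤ κ ^ j * (Real.sqrt κ * B) := by
  rw [hg.iteratedDeriv_profile hκ j]
  dsimp only
  rw [abs_mul, abs_of_nonneg (pow_nonneg (by linarith) _)]
  exact mul_le_mul_of_nonneg_left (abs_profile_le hB κ s) (pow_nonneg (by linarith) _)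

/-- A uniform bound of the first `n` derivatives of a bump. [folklore] -/
theorem IsBump.exists_bound_iteratedDeriv_le (hg : IsBump g) (n : ℕ) :
    ∃ B : ℝ, 0 ≤ B ∧ ∀ j ≤ n, ∀ s, |iteratedDeriv j g s| ≤ B := by
  induction n with
  | zero =>
    obtain ⟨B, hB0, hB⟩ := hg.exists_bound
    exact ⟨B, hB0, fun j hj s => by rw [Nat.le_zero.1 hj]; simpa using hB s⟩
  | succ n ih =>
    obtain ⟨B₀, hB₀, h₀⟩ := ih
    obtain ⟨B₁, hB₁, h₁⟩ := (isBump_iteratedDeriv hg (n + 1)).exists_bound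
    refine ⟨max B₀ B₁, le_max_of_le_left hB₀, fun j hj s => ?_⟩
    rcases Nat.lt_or_ge j (n + 1) with hlt | hge
    · exact (h₀ j (Nat.lt_succ_iff.1 hlt) s).trans (le_max_left _ _)
    · rw [le_antisymm hj hge]
      exact (h₁ s).trans (le_max_right _ _)

end Intermittent

/-! ## The axial function: iterated partial derivatives -/

namespace Jet

open FunctionSpaces FunctionSpaces.Torus Mikado NashGeometric Transverse

variable {d : Type*} [Fintype d] [DecidableEq d]

section Axial

variable {P : ℝ → ℝ}

omit [Fintype d] [DecidableEq d] in
/-- Iterated derivatives of a `1`-periodic function are `1`-periodic. [folklore] -/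
theorem periodic_iteratedDeriv (hP : Periodic P 1) : ∀ j : ℕ, Periodic (iteratedDeriv j P) 1
  | 0 => by simpa using hP
  | j + 1 => by
    rw [iteratedDeriv_succ]
    exact periodic_deriv (periodic_iteratedDeriv hP j)

omit [Fintype d] [DecidableEq d] in
/-- Iterated derivatives of a smooth function are smooth. [folklore] -/
theorem contDiff_iteratedDeriv_of_contDiff (hPs : ContDiff ℝ ∞ P) (j : ℕ) : ContDiff ℝ ∞ (iteratedDeriv j P) := by
  rw [iteratedDeriv_eq_iterate]
  exact hPs.iterate_deriv j

/-- **Iterated partial derivatives of the axial function**: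
`∂^l P̃(χ_n y + r) = (∏_{i ∈ l} nᵢ) · P̃^{(|l|)}(χ_n y + r)` for smooth periodic `P`. [folklore] -/
theorem iterPartialDeriv_axialFn (hP : Periodic P 1) (hPs : ContDiff ℝ ∞ P) (n : d → ℤ) (r : ℝ) :
    ∀ l : List d, iterPartialDeriv l (axialFn hP n r) =
      fun y => (l.map fun i => (n i : ℝ)).prod * axialFn (periodic_iteratedDeriv hP l.length) n r y
  | [] => by funext y; simp [axialFn]
  | i :: l => by
    rw [iterPartialDeriv_cons, iterPartialDeriv_axialFn hP hPs n r l]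
    funext y
    have hQ : ContDiff ℝ ∞ (iteratedDeriv l.length P) := contDiff_iteratedDeriv_of_contDiff hPs _
    have hsm : IsSmooth (axialFn (periodic_iteratedDeriv hP l.length) n r) := isSmooth_axialFn _ hQ n r
    rw [Torus.partialDeriv_const_mul_apply (hsm.isContDiff (by simp)),
      partialDeriv_axialFn _ (hQ.of_le (by exact_mod_cast le_top)) n r i y]
    simp only [List.map_cons, List.prod_cons, List.length_cons]
    have e : axialFn (periodic_deriv (periodic_iteratedDeriv hP l.length)) n r y =
        axialFn (periodic_iteratedDeriv hP (l.length + 1)) n r y := by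
      simp only [axialFn, iteratedDeriv_succ]
    rw [e]
    ring

omit [Fintype d] [DecidableEq d] in
/-- `|∏_{i∈l} nᵢ| ≤ M^{|l|}` when `|nᵢ| ≤ M`. [folklore] -/
theorem abs_prod_map_le {n : d → ℝ} {M : ℝ} (hM : ∀ i, |n i| ≤ M) :
    ∀ l : List d, |(l.map n).prod| ≤ M ^ l.length
  | [] => by simp
  | i :: l => by
    simp only [List.map_cons, List.prod_cons, List.length_cons, abs_mul, pow_succ]
    rw [mul_comm (M ^ l.length)]
    exact mul_le_mul (hM i) (abs_prod_map_le hM l) (abs_nonneg _) ((abs_nonneg _).trans (hM i))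

/-- **Derivative bounds of every order for the axial function**: if `|P^{(j)}| ≤ K ρ^j` for
`j ≤ N` and `|nᵢ| ≤ M` (`M, ρ ≥ 0`), then `HasDerivBounds N (P̃(χ_n · + r)) K (Mρ)`. [folklore] -/
theorem hasDerivBounds_axialFn (hP : Periodic P 1) (hPs : ContDiff ℝ ∞ P) {n : d → ℤ} (r : ℝ) {N : ℕ}
    {K ρ M : ℝ} (hM0 : 0 ≤ M) (hM : ∀ i, |(n i : ℝ)| ≤ M)
    (hK : ∀ j ≤ N, ∀ s, |iteratedDeriv j P s| ≤ K * ρ ^ j) :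
    HasDerivBounds N (axialFn hP n r) K (M * ρ) := by
  refine ⟨isSmooth_axialFn hP hPs n r, fun l hl y => ?_⟩
  rw [iterPartialDeriv_axialFn hP hPs n r l]
  dsimp only
  rw [Real.norm_eq_abs, abs_mul, mul_pow, ← mul_assoc, mul_comm K, mul_assoc]
  refine mul_le_mul (abs_prod_map_le hM l) ?_ (abs_nonneg _) (pow_nonneg hM0 _)
  obtain ⟨Y, rfl⟩ := proj_surjective y
  rw [axialFn_proj]
  exact hK _ hl _

end Axial

/-! ## The axial factors `η_x`, `η'_x` of the intermittent jets -/

section Eta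

/-- `|(σ k_x)ₗ| ≤ 3σ`. [folklore] -/
theorem abs_nvec_le {J : Params} (x : Index d) (l : d) : |(((nvec J) x l : ℤ) : ℝ)| ≤ 3 * J.σ := by
  simp only [nvec, Int.cast_mul, Int.cast_natCast, abs_mul, Nat.abs_cast]
  rw [mul_comm]
  exact mul_le_mul_of_nonneg_right (CL22.abs_dir_le x l) (Nat.cast_nonneg _)

/-- **Derivative bounds of every order for `η_x(t)`**: for a bump `g` there is `A = A(g, N) ≥ 0`
with `HasDerivBounds N (η_x(t)) (A κ^{1/2}) (3σκ)` for all admissible parameters with axial bump `g`,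
all directions `x` and times `t` (each derivative costs `σ|k_x| κ ≤ 3σκ`; the height of `g_κ` is
`κ^{1/2}`). [cite: BuckmasterVicol2020, §7.4 (7.22)] -/
theorem hasDerivBounds_eta {g : ℝ → ℝ} (hg : Intermittent.IsBump g) (N : ℕ) :
    ∃ A : ℝ, 0 ≤ A ∧ ∀ (J : Params), J.Valid → J.g = g → ∀ (x : Index d) (t : ℝ),
      HasDerivBounds N ((eta J) x t) (A * Real.sqrt J.κ) (3 * J.σ * J.κ) := by
  obtain ⟨B, hB0, hB⟩ := hg.exists_bound_iteratedDeriv_le N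
  refine ⟨B, hB0, fun J h hJg x t => ?_⟩
  subst hJg
  have hκ0 : 0 ≤ J.κ := le_trans zero_le_one h.hκ
  have hK : ∀ j ≤ N, ∀ s, |iteratedDeriv j (prof J) s| ≤ B * Real.sqrt J.κ * J.κ ^ j := by
    intro j hj s
    have := h.hg.abs_iteratedDeriv_profile_le h.hκ j (hB j hj) s
    calc |iteratedDeriv j (prof J) s| ≤ J.κ ^ j * (Real.sqrt J.κ * B) := this
      _ = B * Real.sqrt J.κ * J.κ ^ j := by ring
  have := hasDerivBounds_axialFn (prof_periodic J) (contDiff_prof h) (J.om * t)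
    (by positivity : (0 : ℝ) ≤ 3 * J.σ) (abs_nvec_le x) hK
  simpa [eta, mul_comm, mul_assoc, mul_left_comm] using this

/-- **Derivative bounds of every order for `η'_x(t)`** (the axial factor of `(g_κ)' = κ(g')_κ`):
`HasDerivBounds N (η'_x(t)) (A κ^{3/2}) (3σκ)`. [cite: BuckmasterVicol2020, §7.4 (7.22)] -/
theorem hasDerivBounds_etaD {g : ℝ → ℝ} (hg : Intermittent.IsBump g) (N : ℕ) :
    ∃ A : ℝ, 0 ≤ A ∧ ∀ (J : Params), J.Valid → J.g = g → ∀ (x : Index d) (t : ℝ),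
      HasDerivBounds N ((etaD J) x t) (A * (J.κ * Real.sqrt J.κ)) (3 * J.σ * J.κ) := by
  obtain ⟨B, hB0, hB⟩ := hg.exists_bound_iteratedDeriv_le (N + 1)
  refine ⟨B, hB0, fun J h hJg x t => ?_⟩
  subst hJg
  have hκ0 : 0 ≤ J.κ := le_trans zero_le_one h.hκ
  have hK : ∀ j ≤ N, ∀ s, |iteratedDeriv j (deriv (prof J)) s| ≤ B * (J.κ * Real.sqrt J.κ) * J.κ ^ j := by
    intro j hj s
    rw [← iteratedDeriv_succ']
    have := h.hg.abs_iteratedDeriv_profile_le h.hκ (j + 1) (hB (j + 1) (by omega)) s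
    calc |iteratedDeriv (j + 1) (prof J) s| ≤ J.κ ^ (j + 1) * (Real.sqrt J.κ * B) := this
      _ = B * (J.κ * Real.sqrt J.κ) * J.κ ^ j := by ring
  have := hasDerivBounds_axialFn (periodic_deriv (prof_periodic J)) (contDiff_deriv_prof h) (J.om * t)
    (by positivity : (0 : ℝ) ≤ 3 * J.σ) (abs_nvec_le x) hK
  simpa [etaD, mul_comm, mul_assoc, mul_left_comm] using this

end Eta

end Jet

/-! ## Transverse profiles on `ℝ^m`: iterated partial derivatives -/

namespace Transverse

variable {m : Type*} [Fintype m] [DecidableEq m]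

/-- The iterated partial derivative `∂_{l₀}(∂_{l₁}(⋯ f₀))` of a profile on `ℝ^m` along a list of
coordinate directions (head outermost), with the `pd` of `FluidPDE/TransverseProfile`. [folklore] -/
def iterPd : List m → (EuclideanSpace ℝ m → ℝ) → EuclideanSpace ℝ m → ℝ
  | [] => fun f => f
  | l :: ls => fun f => pd l (iterPd ls f)

omit [Fintype m] in
/-- `∂^{[]} f = f`. [folklore] -/
@[simp] theorem iterPd_nil (f : EuclideanSpace ℝ m → ℝ) : iterPd [] f = f := rfl

omit [Fintype m] in
/-- `∂^{l :: ls} f = ∂ₗ (∂^{ls} f)`. [folklore] -/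
@[simp] theorem iterPd_cons (l : m) (ls : List m) (f : EuclideanSpace ℝ m → ℝ) :
    iterPd (l :: ls) f = pd l (iterPd ls f) := rfl

omit [Fintype m] in
/-- `∂^{ls ++ [l]} f = ∂^{ls} (∂ₗ f)`. [folklore] -/
theorem iterPd_concat (ls : List m) (l : m) (f : EuclideanSpace ℝ m → ℝ) :
    iterPd (ls ++ [l]) f = iterPd ls (pd l f) := by
  induction ls with
  | nil => rfl
  | cons i ls ih => simp [ih]

/-- Iterated partial derivatives of profiles are profiles. [folklore] -/
theorem isProfile_iterPd {f₀ : EuclideanSpace ℝ m → ℝ} (hf : IsProfile f₀) : ∀ ls : List m, IsProfile (iterPd ls f₀)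
  | [] => hf
  | l :: ls => by
    rw [iterPd_cons]
    exact (isProfile_iterPd hf ls).pd l

/-- **Uniform bound of all iterated partial derivatives up to order `n` of a profile.** [folklore] -/
theorem IsProfile.exists_bound_iterPd (n : ℕ) :
    ∀ {f₀ : EuclideanSpace ℝ m → ℝ}, IsProfile f₀ →
      ∃ B : ℝ, 0 ≤ B ∧ ∀ ls : List m, ls.length ≤ n → ∀ z, |iterPd ls f₀ z| ≤ B := by
  induction n with
  | zero =>
    intro f₀ hf
    obtain ⟨B, hB0, hB⟩ := hf.exists_bound
    refine ⟨B, hB0, fun ls hls z => ?_⟩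
    have : ls = [] := List.eq_nil_of_length_eq_zero (Nat.le_zero.1 hls)
    subst this
    exact hB z
  | succ n ih =>
    intro f₀ hf
    obtain ⟨B₀, hB₀, h₀⟩ := ih hf
    choose Bl hBl hl using fun l : m => ih (hf.pd l)
    refine ⟨B₀ + ∑ l, Bl l, add_nonneg hB₀ (Finset.sum_nonneg fun l _ => hBl l), fun ls hls z => ?_⟩
    have hsum : ∀ j, Bl j ≤ B₀ + ∑ l, Bl l := fun j =>
      le_add_of_nonneg_of_le hB₀ (Finset.single_le_sum (fun l _ => hBl l) (Finset.mem_univ j))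
    rcases Nat.lt_or_ge ls.length (n + 1) with hlt | hge
    · exact (h₀ ls (Nat.lt_succ_iff.1 hlt) z).trans (le_add_of_nonneg_right (Finset.sum_nonneg fun l _ => hBl l))
    · have hlen : ls.length = n + 1 := le_antisymm hls hge
      obtain ⟨ls', l, rfl, hlen'⟩ := FunctionSpaces.Torus.List.exists_eq_concat_of_length_eq_succ hlen
      rw [iterPd_concat]
      exact (hl l ls' hlen'.le z).trans (hsum l)

end Transverse

/-! ## Pulled-back concentrated profiles on `𝕋^d` -/

namespace Mikado

open FunctionSpaces FunctionSpaces.Torus Transverse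

variable {d : Type*} [Fintype d] [DecidableEq d]
variable {m : Type*} [Fintype m] [DecidableEq m] (T : TransverseDatum d m)

/-- The size `Λ = ∑ₗ ∑_{l'} |A l l'|` of the integer frame of a transverse datum (bounds every row
sum `∑_{l'} |A i l'|`). [folklore] -/
def frameSize : ℝ := ∑ l, ∑ l', |(T.A l l' : ℝ)|

omit [DecidableEq d] in
/-- `0 ≤ Λ`. [folklore] -/
theorem frameSize_nonneg : 0 ≤ frameSize T :=
  Finset.sum_nonneg fun _ _ => Finset.sum_nonneg fun _ _ => abs_nonneg _

omit [DecidableEq d] in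
/-- A row sum of `|A|` is at most `Λ`. [folklore] -/
theorem sum_abs_le_frameSize (i : d) : ∑ l', |(T.A i l' : ℝ)| ≤ frameSize T :=
  Finset.single_le_sum (f := fun l => ∑ l', |(T.A l l' : ℝ)|) (fun _ _ => Finset.sum_nonneg fun _ _ => abs_nonneg _)
    (Finset.mem_univ i)

/-- `∂^l (c f) = c ∂^l f` for real constants and smooth real `f`. [folklore] -/
theorem iterPartialDeriv_const_mul {f : UnitAddTorus d → ℝ} (hf : IsSmooth f) (c : ℝ) (l : List d) :
    iterPartialDeriv l (fun y => c * f y) = fun y => c * iterPartialDeriv l f y := by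
  have h := iterPartialDeriv_const_smul hf c l
  simp only [smul_eq_mul] at h
  exact h

variable {f₀ : EuclideanSpace ℝ m → ℝ} {κ₀ μ : ℝ}

/-- **Iterated derivatives of pulled-back concentrated profiles**: if all iterated partial
derivatives of the profile `f₀` up to order `n` are bounded by `B`, then for `|l| ≤ n`
`|∂^l (conc κ₀ a μ f₀ ∘ L)| ≤ |κ₀| μ^a B (Λμ)^{|l|}` — each derivative costs one power of the
concentration `μ` and one frame entry (`∂ₗ(conc κ₀ a μ f₀ ∘ L) = ∑_{l'} A l l' conc κ₀ (a+1) μ (∂_{l'}f₀) ∘ L`).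
[cite: BuckmasterVicol2020, §7.4 (7.22)] -/
theorem abs_iterPartialDeriv_pull_conc_le (hμ : 1 ≤ μ) (κ₀ : ℝ) (n : ℕ) :
    ∀ {f₀ : EuclideanSpace ℝ m → ℝ}, IsProfile f₀ → ∀ {B : ℝ},
      (∀ ls : List m, ls.length ≤ n → ∀ z, |iterPd ls f₀ z| ≤ B) →
      ∀ (a : ℝ) (l : List d), l.length ≤ n → ∀ y,
        |iterPartialDeriv l (T.pull (conc κ₀ a μ f₀)) y| ≤ |κ₀| * μ ^ a * B * (frameSize T * μ) ^ l.length := by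
  have hμ0 : 0 < μ := by linarith
  induction n with
  | zero =>
    intro f₀ hf B hB a l hl y
    have : l = [] := List.eq_nil_of_length_eq_zero (Nat.le_zero.1 hl)
    subst this
    simp only [iterPartialDeriv_nil, List.length_nil, pow_zero, mul_one]
    exact abs_pull_conc_le T hf hμ (fun z => hB [] (by simp) z) κ₀ a y
  | succ n ih =>
    intro f₀ hf B hB a l hl y
    rcases Nat.lt_or_ge l.length (n + 1) with hlt | hge
    · exact ih hf (fun ls hls z => hB ls (hls.trans (Nat.le_succ n)) z) a l (Nat.lt_succ_iff.1 hlt) y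
    · have hlen : l.length = n + 1 := le_antisymm hl hge
      obtain ⟨l', i, rfl, hlen'⟩ := List.exists_eq_concat_of_length_eq_succ hlen
      rw [iterPartialDeriv_concat, partialDeriv_pull_conc T hf hμ κ₀ a i]
      have hsm : ∀ l'' : m, IsSmooth (T.pull (conc κ₀ (a + 1) μ (pd l'' f₀))) := fun l'' =>
        isSmooth_pull_conc T (hf.pd l'') hμ κ₀ (a + 1)
      rw [iterPartialDeriv_finset_sum Finset.univ
        (f := fun l'' y => (T.A i l'' : ℝ) * T.pull (conc κ₀ (a + 1) μ (pd l'' f₀)) y)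
        (fun l'' _ => ((hsm l'').smul (T.A i l'' : ℝ) : IsSmooth ((T.A i l'' : ℝ) • T.pull (conc κ₀ (a + 1) μ (pd l'' f₀)))))]
      have hterm : ∀ l'' : m, |(T.A i l'' : ℝ) * iterPartialDeriv l' (T.pull (conc κ₀ (a + 1) μ (pd l'' f₀))) y| ≤
          |(T.A i l'' : ℝ)| * (|κ₀| * μ ^ (a + 1) * B * (frameSize T * μ) ^ n) := by
        intro l''
        rw [abs_mul]
        refine mul_le_mul_of_nonneg_left ?_ (abs_nonneg _)
        have hB' : ∀ ls : List m, ls.length ≤ n → ∀ z, |iterPd ls (pd l'' f₀) z| ≤ B := by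
          intro ls hls z
          rw [← iterPd_concat]
          exact hB (ls ++ [l'']) (by simpa using hls) z
        have := ih (hf.pd l'') hB' (a + 1) l' hlen'.le y
        rwa [hlen'] at this
      calc |∑ l'' : m, iterPartialDeriv l' (fun y => (T.A i l'' : ℝ) * T.pull (conc κ₀ (a + 1) μ (pd l'' f₀)) y) y|
          ≤ ∑ l'' : m, |iterPartialDeriv l' (fun y => (T.A i l'' : ℝ) * T.pull (conc κ₀ (a + 1) μ (pd l'' f₀)) y) y| :=
            Finset.abs_sum_le_sum_abs _ _
        _ = ∑ l'' : m, |(T.A i l'' : ℝ) * iterPartialDeriv l' (T.pull (conc κ₀ (a + 1) μ (pd l'' f₀))) y| := by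
            refine Finset.sum_congr rfl fun l'' _ => ?_
            rw [iterPartialDeriv_const_mul (hsm l'') _ l']
        _ ≤ ∑ l'' : m, |(T.A i l'' : ℝ)| * (|κ₀| * μ ^ (a + 1) * B * (frameSize T * μ) ^ n) :=
            Finset.sum_le_sum fun l'' _ => hterm l''
        _ = (∑ l'' : m, |(T.A i l'' : ℝ)|) * (|κ₀| * μ ^ (a + 1) * B * (frameSize T * μ) ^ n) := by
            rw [Finset.sum_mul]
        _ ≤ frameSize T * (|κ₀| * μ ^ (a + 1) * B * (frameSize T * μ) ^ n) := by
            refine mul_le_mul_of_nonneg_right (sum_abs_le_frameSize T i) ?_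
            have hB0 : 0 ≤ B := (abs_nonneg _).trans (hB [] (by simp) 0)
            have := frameSize_nonneg T
            positivity
        _ = |κ₀| * μ ^ a * B * (frameSize T * μ) ^ (l' ++ [i]).length := by
            rw [List.length_append, List.length_singleton, hlen', Real.rpow_add_one hμ0.ne' a]
            ring

/-- **Derivative bounds of every order for pulled-back concentrated profiles**:
`HasDerivBounds n (conc κ₀ a μ f₀ ∘ L) (|κ₀| μ^a B) (Λμ)`. [cite: BuckmasterVicol2020, §7.4 (7.22)] -/
theorem hasDerivBounds_pull_conc (hμ : 1 ≤ μ) (κ₀ a : ℝ) (hf : IsProfile f₀) (n : ℕ) {B : ℝ}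
    (hB : ∀ ls : List m, ls.length ≤ n → ∀ z, |iterPd ls f₀ z| ≤ B) :
    HasDerivBounds n (T.pull (conc κ₀ a μ f₀)) (|κ₀| * μ ^ a * B) (frameSize T * μ) :=
  ⟨isSmooth_pull_conc T hf hμ κ₀ a, fun l hl y => by
    rw [Real.norm_eq_abs]
    exact abs_iterPartialDeriv_pull_conc_le T hμ κ₀ n hf hB a l hl y⟩

/-! ## Dilated and translated arguments `y ↦ f(σ • (y - s))` -/

omit [DecidableEq d] in
/-- **`∂^l (f(σ • (· - s))) = σ^{|l|} (∂^l f)(σ • (· - s))`** for smooth `f`. [folklore] -/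
theorem iterPartialDeriv_comp_nsmul_sub [DecidableEq d] {F : Type*} [NormedAddCommGroup F] [NormedSpace ℝ F]
    {f : UnitAddTorus d → F} (hf : IsSmooth f) (σ : ℕ) (s : UnitAddTorus d) :
    ∀ l : List d, iterPartialDeriv l (fun y => f (σ • (y - s))) =
      fun y => ((σ : ℝ) ^ l.length) • iterPartialDeriv l f (σ • (y - s))
  | [] => by funext y; simp
  | i :: l => by
    rw [iterPartialDeriv_cons, iterPartialDeriv_comp_nsmul_sub hf σ s l, iterPartialDeriv_cons]
    have hg : IsSmooth (iterPartialDeriv l f) := hf.iterPartialDeriv l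
    have hcomp : IsSmooth (fun y => iterPartialDeriv l f (σ • (y - s))) :=
      isSmooth_comp_sub (isSmooth_comp_nsmul hg σ) s
    funext y
    have e0 : (fun y => ((σ : ℝ) ^ l.length) • iterPartialDeriv l f (σ • (y - s))) =
        ((σ : ℝ) ^ l.length) • fun y => iterPartialDeriv l f (σ • (y - s)) := rfl
    have e1 : Torus.partialDeriv i (fun y => iterPartialDeriv l f (σ • (y - s))) y =
        (σ : ℝ) • Torus.partialDeriv i (iterPartialDeriv l f) (σ • (y - s)) := by
      have h1 := congr_fun (partialDeriv_comp_sub i (fun z => iterPartialDeriv l f (σ • z)) s) y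
      rw [h1, Literature.Analysis.FluidPDE.partialDeriv_comp_nsmul]
    rw [e0, FunctionSpaces.Torus.partialDeriv_const_smul (hcomp.isContDiff (by simp)), Pi.smul_apply, e1, smul_smul,
      List.length_cons, pow_succ]

omit [DecidableEq d] in
/-- Derivative bounds transfer to `y ↦ f(σ • (y - s))` with `L ↦ σL`. [folklore] -/
theorem _root_.Literature.Analysis.FunctionSpaces.Torus.HasDerivBounds.comp_nsmul_sub [DecidableEq d]
    {F : Type*} [NormedAddCommGroup F] [NormedSpace ℝ F] {f : UnitAddTorus d → F} {n : ℕ} {C L : ℝ}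
    (h : HasDerivBounds n f C L) (σ : ℕ) (s : UnitAddTorus d) :
    HasDerivBounds n (fun y => f (σ • (y - s))) C (σ * L) := by
  refine ⟨isSmooth_comp_sub (isSmooth_comp_nsmul h.1 σ) s, fun l hl y => ?_⟩
  rw [iterPartialDeriv_comp_nsmul_sub h.1 σ s l]
  dsimp only
  rw [norm_smul, norm_pow, Real.norm_natCast, mul_pow, mul_left_comm]
  exact mul_le_mul_of_nonneg_left (h.2 l hl _) (pow_nonneg (Nat.cast_nonneg _) _)

end Mikado

/-! ## The transverse factor `ψ̃_x` and potential gradient `∇φ̃_x` of the intermittent jets -/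

namespace Jet

open FunctionSpaces FunctionSpaces.Torus Mikado NashGeometric Transverse

variable {d : Type*} [Fintype d] [DecidableEq d]

/-- A frame constant dominating the frame sizes of all directions: `Λ₀ = 1 + ∑ₓ Λ(datum x) ≥ 1`. [folklore] -/
def frameConst (d : Type*) [Fintype d] [DecidableEq d] : ℝ := 1 + ∑ x : Index d, frameSize (datum x)

/-- `1 ≤ Λ₀`. [folklore] -/
theorem one_le_frameConst : 1 ≤ frameConst d :=
  le_add_of_nonneg_right (Finset.sum_nonneg fun _ _ => frameSize_nonneg _)

/-- `Λ(datum x) ≤ Λ₀`. [folklore] -/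
theorem frameSize_le_frameConst (x : Index d) : frameSize (datum x) ≤ frameConst d :=
  (Finset.single_le_sum (f := fun x => frameSize (datum x)) (fun _ _ => frameSize_nonneg _)
    (Finset.mem_univ x)).trans (le_add_of_nonneg_left zero_le_one)

/-! ## The transverse factor `ψ̃_x` and the potential gradient `∇φ̃_x` -/

section TransverseFactors

/-- Positivity and size facts for admissible parameters. [folklore] -/
theorem Params.Valid.pos {J : Params} (h : J.Valid) : 0 < J.μ ∧ (0 : ℝ) < J.σ ∧ 1 ≤ J.μ ∧ (1 : ℝ) ≤ J.σ := by
  have hσ : (1 : ℝ) ≤ J.σ := by exact_mod_cast h.hσ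
  exact ⟨by linarith [h.hμ], by linarith, h.hμ, hσ⟩

/-- `σ (Λ(datum x) μ) ≤ Λ₀ σ μ`. [folklore] -/
theorem frame_L_le {J : Params} (h : J.Valid) (x : Index d) :
    (J.σ : ℝ) * (frameSize (datum x) * J.μ) ≤ frameConst d * J.σ * J.μ := by
  obtain ⟨hμ0, hσ0, -, -⟩ := h.pos
  have hF := frameSize_le_frameConst x
  calc (J.σ : ℝ) * (frameSize (datum x) * J.μ) = frameSize (datum x) * (J.σ * J.μ) := by ring
    _ ≤ frameConst d * (J.σ * J.μ) := mul_le_mul_of_nonneg_right hF (by positivity)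
    _ = frameConst d * J.σ * J.μ := by ring

variable (d) in
/-- **Derivative bounds of every order for the transverse factor `ψ̃_x`**: there are
`C_x = C_x(d, N) ≥ 0` such that for all admissible parameters, shifts and directions
`HasDerivBounds N ψ̃_x (C_x μ^{(d-1)/2}) (Λ₀σμ)` — the height of the transverse pipe profile is
`μ^{(d-1)/2}` and each derivative costs the transverse frequency `σμ` (times the frame constant).
[cite: BuckmasterVicol2020, §7.4 (7.22)] -/
theorem hasDerivBounds_psiJ (N : ℕ) : ∃ C : Index d → ℝ, (∀ x, 0 ≤ C x) ∧
    ∀ (J : Params), J.Valid → ∀ (s : Index d → UnitAddTorus d) (x : Index d),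
      HasDerivBounds N (psiJ J s x) (C x * J.μ ^ (((Fintype.card d : ℝ) - 1) / 2)) (frameConst d * J.σ * J.μ) := by
  have key : ∀ x : Index d, ∃ Cx : ℝ, 0 ≤ Cx ∧ ∀ (J : Params), J.Valid → ∀ s : Index d → UnitAddTorus d,
      HasDerivBounds N (psiJ J s x) (Cx * J.μ ^ (((Fintype.card d : ℝ) - 1) / 2)) (frameConst d * J.σ * J.μ) := by
    intro x
    obtain ⟨B, hB0, hB⟩ := IsProfile.exists_bound_iterPd N (isProfile_psi0 (datum x).c)
    refine ⟨|normConst (datum x).c| * B, by positivity, fun J h s => ?_⟩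
    obtain ⟨hμ0, hσ0, hμ1, -⟩ := h.pos
    have h1 : HasDerivBounds N (psi x J.μ)
        (|normConst (datum x).c| * J.μ ^ ((Fintype.card (Slot x) : ℝ) / 2) * B) (frameSize (datum x) * J.μ) :=
      hasDerivBounds_pull_conc (datum x) hμ1 (normConst (datum x).c) ((Fintype.card (Slot x) : ℝ) / 2)
        (isProfile_psi0 (datum x).c) N hB
    rw [card_slot_real x] at h1
    have h2 : HasDerivBounds N (psiJ J s x)
        (|normConst (datum x).c| * J.μ ^ (((Fintype.card d : ℝ) - 1) / 2) * B) (J.σ * (frameSize (datum x) * J.μ)) :=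
      h1.comp_nsmul_sub J.σ (s x)
    exact h2.mono (le_of_eq (by ring)) (by have := frameSize_nonneg (datum x); positivity) (frame_L_le h x)
  choose C hC0 hC using key
  exact ⟨C, hC0, fun J h s x => hC x J h s⟩

variable (d) in
/-- **Derivative bounds of every order for `∂ⱼφ̃_x`**: there are `C_x = C_x(d, N) ≥ 0` with
`HasDerivBounds N (∂ⱼφ̃_x) (C_x σ⁻¹ μ^{(d-1)/2-1}) (Λ₀σμ)` for all admissible parameters, shifts,
directions and coordinates `j` (the corrector gain `σ⁻¹` of `∇(σ⁻²φ(σ·)) = σ⁻¹(∇φ)(σ·)`; in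
`d = 3` the height `μ^{(d-1)/2-1}` is `1`). [cite: BuckmasterVicol2020, §7.4 (7.23)] -/
theorem hasDerivBounds_partialDeriv_phiJ (N : ℕ) : ∃ C : Index d → ℝ, (∀ x, 0 ≤ C x) ∧
    ∀ (J : Params), J.Valid → ∀ (s : Index d → UnitAddTorus d) (x : Index d) (j : d),
      HasDerivBounds N (Torus.partialDeriv j (phiJ J s x))
        (C x * (((J.σ : ℝ))⁻¹ * J.μ ^ (((Fintype.card d : ℝ) - 1) / 2 - 1))) (frameConst d * J.σ * J.μ) := by
  have key : ∀ x : Index d, ∃ Cx : ℝ, 0 ≤ Cx ∧ ∀ (J : Params), J.Valid → ∀ (s : Index d → UnitAddTorus d) (j : d),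
      HasDerivBounds N (Torus.partialDeriv j (phiJ J s x))
        (Cx * (((J.σ : ℝ))⁻¹ * J.μ ^ (((Fintype.card d : ℝ) - 1) / 2 - 1))) (frameConst d * J.σ * J.μ) := by
    intro x
    set c := (datum x).c with hc
    obtain ⟨B, hB0, hB⟩ := IsProfile.exists_bound_iterPd (N + 1) (isProfile_phi0 c)
    refine ⟨frameSize (datum x) * (|normConst c| * B), by have := frameSize_nonneg (datum x); positivity,
      fun J h s j => ?_⟩
    obtain ⟨hμ0, hσ0, hμ1, hσ1⟩ := h.pos
    set a₀ : ℝ := (Fintype.card (Slot x) : ℝ) / 2 - 2 with ha₀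
    -- the derivative of the unscaled potential, as a sum of pulled-back profiles
    set G : UnitAddTorus d → ℝ := fun y => ∑ l', ((datum x).A j l' : ℝ) *
      (datum x).pull (conc (normConst c) (a₀ + 1) J.μ (pd l' (phi0 c))) y with hG_def
    have eG : Torus.partialDeriv j (phi x J.μ) = G :=
      partialDeriv_pull_conc (datum x) (isProfile_phi0 c) hμ1 (normConst c) a₀ j
    have hB' : ∀ l' : Slot x, ∀ ls : List (Slot x), ls.length ≤ N → ∀ z, |iterPd ls (pd l' (phi0 c)) z| ≤ B := by
      intro l' ls hls z
      rw [← iterPd_concat]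
      exact hB (ls ++ [l']) (by simpa using hls) z
    have hterm : ∀ l' : Slot x, HasDerivBounds N
        (fun y => ((datum x).A j l' : ℝ) * (datum x).pull (conc (normConst c) (a₀ + 1) J.μ (pd l' (phi0 c))) y)
        (|((datum x).A j l' : ℝ)| * (|normConst c| * J.μ ^ (a₀ + 1) * B)) (frameSize (datum x) * J.μ) := fun l' =>
      (hasDerivBounds_pull_conc (datum x) hμ1 (normConst c) (a₀ + 1) ((isProfile_phi0 c).pd l') N (hB' l')).const_smul _
    have hG : HasDerivBounds N G (∑ l', |((datum x).A j l' : ℝ)| * (|normConst c| * J.μ ^ (a₀ + 1) * B))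
        (frameSize (datum x) * J.μ) := HasDerivBounds.sum Finset.univ fun l' _ => hterm l'
    -- `∂ⱼφ̃ (y) = σ⁻¹ G(σ • (y - s))`
    have e1 : Torus.partialDeriv j (phiJ J s x) = fun y => ((J.σ : ℝ))⁻¹ * G (J.σ • (y - s x)) := by
      funext y
      have h1 := congr_fun (partialDeriv_comp_sub j (phiR x J.μ J.σ) (s x)) y
      rw [show phiJ J s x = fun y => phiR x J.μ J.σ (y - s x) from rfl, h1, partialDeriv_phiR x hμ1 h.hσ, eG]
    have h2 : HasDerivBounds N (fun y => ((J.σ : ℝ))⁻¹ * G (J.σ • (y - s x)))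
        (|((J.σ : ℝ))⁻¹| * ∑ l', |((datum x).A j l' : ℝ)| * (|normConst c| * J.μ ^ (a₀ + 1) * B)) (J.σ * (frameSize (datum x) * J.μ)) :=
      (hG.comp_nsmul_sub J.σ (s x)).const_smul _
    rw [← e1] at h2
    refine h2.mono ?_ (by have := frameSize_nonneg (datum x); positivity) (frame_L_le h x)
    -- constants
    have eexp : J.μ ^ (a₀ + 1) = J.μ ^ (((Fintype.card d : ℝ) - 1) / 2 - 1) := by
      rw [ha₀, card_slot_real x]; ring_nf
    rw [abs_of_pos (inv_pos.2 hσ0), eexp, ← Finset.sum_mul]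
    have hrow := sum_abs_le_frameSize (datum x) j
    have : 0 ≤ |normConst c| * J.μ ^ (((Fintype.card d : ℝ) - 1) / 2 - 1) * B := by positivity
    calc ((J.σ : ℝ))⁻¹ * ((∑ l', |((datum x).A j l' : ℝ)|) * (|normConst c| * J.μ ^ (((Fintype.card d : ℝ) - 1) / 2 - 1) * B))
        ≤ ((J.σ : ℝ))⁻¹ * (frameSize (datum x) * (|normConst c| * J.μ ^ (((Fintype.card d : ℝ) - 1) / 2 - 1) * B)) :=
          mul_le_mul_of_nonneg_left (mul_le_mul_of_nonneg_right hrow this) (inv_nonneg.2 hσ0.le)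
      _ = frameSize (datum x) * (|normConst c| * B) * (((J.σ : ℝ))⁻¹ * J.μ ^ (((Fintype.card d : ℝ) - 1) / 2 - 1)) := by ring
  choose C hC0 hC using key
  exact ⟨C, hC0, fun J h s x j => hC x J h s j⟩

variable (d) in
/-- **Derivative bounds of every order for `∇φ̃_x`** (vector form of the previous statement, with
the Leibniz constant `2^N |d|`). [cite: BuckmasterVicol2020, §7.4 (7.23)] -/
theorem hasDerivBounds_gradient_phiJ (N : ℕ) : ∃ C : Index d → ℝ, (∀ x, 0 ≤ C x) ∧
    ∀ (J : Params), J.Valid → ∀ (s : Index d → UnitAddTorus d) (x : Index d),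
      HasDerivBounds N (Torus.gradient (phiJ J s x))
        (C x * (((J.σ : ℝ))⁻¹ * J.μ ^ (((Fintype.card d : ℝ) - 1) / 2 - 1))) (frameConst d * J.σ * J.μ) := by
  obtain ⟨C, hC0, hC⟩ := hasDerivBounds_partialDeriv_phiJ d N
  refine ⟨fun x => Fintype.card d * (2 ^ N * C x), fun x => by have := hC0 x; positivity, fun J h s x => ?_⟩
  obtain ⟨hμ0, hσ0, hμ1, hσ1⟩ := h.pos
  have hL : 0 ≤ frameConst d * J.σ * J.μ := by have := one_le_frameConst (d := d); positivity
  have hφ : IsSmooth (phiJ J s x) := isSmooth_phiJ s h x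
  have e : Torus.gradient (phiJ J s x) = fun y => ∑ i, Torus.partialDeriv i (phiJ J s x) y • EuclideanSpace.single i (1 : ℝ) :=
    funext fun y => gradient_eq_sum_partialDeriv (hφ.isContDiff (by simp)) y
  rw [e]
  have hterm : ∀ i : d, HasDerivBounds N (fun y => Torus.partialDeriv i (phiJ J s x) y • EuclideanSpace.single i (1 : ℝ))
      (2 ^ N * (C x * (((J.σ : ℝ))⁻¹ * J.μ ^ (((Fintype.card d : ℝ) - 1) / 2 - 1))) * 1) (frameConst d * J.σ * J.μ) := by
    intro i
    have hv := hasDerivBounds_const (d := d) N (EuclideanSpace.single i (1 : ℝ)) hL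
    have hn : ‖EuclideanSpace.single i (1 : ℝ)‖ = 1 := by simp
    rw [hn] at hv
    exact (hC J h s x i).smul hv hL
  have hsum := HasDerivBounds.sum Finset.univ fun i _ => hterm i
  refine hsum.mono (le_of_eq ?_) hL le_rfl
  rw [Finset.sum_const, Finset.card_univ, nsmul_eq_mul]
  ring

end TransverseFactors

end Jet

end Literature.Analysis.FluidPDE
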